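import Literature.AlgebraicGeometry.Modules.PullbackTensor
import Literature.AlgebraicGeometry.Modules.BoxTensor
import Literature.AlgebraicGeometry.Motives.AbelianVarietyTranslationInvariantAmple
import HarnessLib

/-!
# Base change of the external tensor product: `g^*(E ⊠ F) ≅ u^*E ⊠ v^*F`, and
# `t_{(x,y)}^*(E ⊠ F) ≅ t_x^*E ⊠ t_y^*F` on a product of abelian varieties

For a map of spans — `g : Z' ⟶ Z`, `u : X' ⟶ X`, `v : Y' ⟶ Y` with `g ≫ p = p' ≫ u`, `g ≫ q = q' ≫ v`
(`p : Z ⟶ X`, `q : Z ⟶ Y`, `p' : Z' ⟶ X'`, `q' : Z' ⟶ Y'`) — and FINITE LOCALLY FREE `E` on `X`, `F` on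
`Y`, the external tensor product `E ⊠ F = p^*E ⊗ q^*F` (`Modules/BoxTensor.boxTensor`, Görtz–Wedhorn II
(22.25)) satisfies **`g^*(E ⊠_{p,q} F) ≅ (u^*E) ⊠_{p',q'} (v^*F)`** (`pullbackBoxTensorIso`): pull-back
commutes with the tensor product of vector bundles (`Modules/PullbackTensor.pullbackTensorIso`, Stacks
01CA Lemma 17.16.4) and with composition (Mathlib `Scheme.Modules.pullbackComp`, `pullbackCongr`).
The case recorded by `Modules/BoxTensor` as "NOT HERE": for abelian varieties `A`, `B` over a field
`K`, a `K`-point `z = (x, y)` of `A × B` and vector bundles `E` on `A`, `F` on `B`,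
**`t_z^*(E ⊠ F) ≅ (t_x^*E) ⊠ (t_y^*F)`** (`AbelianVariety.pullbackTranslationBoxTensorIso`), since
translations of a product are componentwise (`Motives.AbelianVariety.translation_comp_hom` for the
projections). Everything is proved; no named facts, no instances, no notation. Use (Hodge programme,
road №4, crux 26512, library item (M3b) «translation-interchange of box products»); library only —
proves nothing about (N-U), 26512, №4, HC_AV or HC.

## References

* The Stacks Project, Tag 01CA (Lemma 17.16.4), Tag 01C8. [StacksProject]
* U. Görtz, T. Wedhorn, *Algebraic Geometry II*, (22.25) before Cor. 22.110 (p. 286); *Algebraic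
  Geometry I*, (7.8.2) (p. 182); II Def./Rem. 27.1 (p. 799) (translations). [GortzWedhorn2023] [GortzWedhorn2020]
-/

noncomputable section

open CategoryTheory AlgebraicGeometry

universe u

namespace Literature.AlgebraicGeometry.Modules

open Literature.AlgebraicGeometry.Motives

/-! ### §1 Pull-back along a commutative square and base change of `⊠` along a map of spans -/

section Span

variable {X X' Y Y' Z Z' : Scheme.{u}} {p : Z ⟶ X} {q : Z ⟶ Y} {p' : Z' ⟶ X'} {q' : Z' ⟶ Y'}
  {g : Z' ⟶ Z} {u : X' ⟶ X} {v : Y' ⟶ Y}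

/-- `g^* p^* E ≅ p'^* u^* E` for a commutative square `g ≫ p = p' ≫ u` (Mathlib's `pullbackComp` and
`pullbackCongr`). [cite: StacksProject, Tag 01C8] -/
def pullbackSquareIso (h : g ≫ p = p' ≫ u) (E : X.Modules) :
    (Scheme.Modules.pullback g).obj ((Scheme.Modules.pullback p).obj E) ≅
      (Scheme.Modules.pullback p').obj ((Scheme.Modules.pullback u).obj E) :=
  (Scheme.Modules.pullbackComp g p).app E ≪≫ (Scheme.Modules.pullbackCongr h).app E ≪≫
    (Scheme.Modules.pullbackComp p' u).symm.app E

/-- **Base change of the external tensor product along a map of spans**: for `g ≫ p = p' ≫ u`,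
`g ≫ q = q' ≫ v` and finite locally free `E`, `F`, `g^*(E ⊠_{p,q} F) ≅ (u^*E) ⊠_{p',q'} (v^*F)`
(`g^*(p^*E ⊗ q^*F) ≅ g^*p^*E ⊗ g^*q^*F` by `pullbackTensorIso`, then the two squares).
[cite: StacksProject, Tag 01CA (Lemma 17.16.4)] [cite: GortzWedhorn2023, §(22.25) (p. 286)] -/
def pullbackBoxTensorIso (hp : g ≫ p = p' ≫ u) (hq : g ≫ q = q' ≫ v) {E : X.Modules} {F : Y.Modules}
    (hE : IsFiniteLocallyFree E) (hF : IsFiniteLocallyFree F) :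
    (Scheme.Modules.pullback g).obj (boxTensor p q E F) ≅
      boxTensor p' q' ((Scheme.Modules.pullback u).obj E) ((Scheme.Modules.pullback v).obj F) :=
  pullbackTensorIso g (hE.pullback p) (hF.pullback q) ≪≫
    tensorMapIso (pullbackSquareIso hp E) (pullbackSquareIso hq F)

/-- The base-change isomorphism is the comparison `pullbackTensorHom` followed by the tensor product
of the two square isomorphisms (by construction). [cite: StacksProject, Tag 01CA (Lemma 17.16.4)] -/
theorem pullbackBoxTensorIso_hom (hp : g ≫ p = p' ≫ u) (hq : g ≫ q = q' ≫ v) {E : X.Modules}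
    {F : Y.Modules} (hE : IsFiniteLocallyFree E) (hF : IsFiniteLocallyFree F) :
    (pullbackBoxTensorIso hp hq hE hF).hom =
      pullbackTensorHom g _ _ ≫ tensorMap (pullbackSquareIso hp E).hom (pullbackSquareIso hq F).hom := by
  rw [pullbackBoxTensorIso, Iso.trans_hom, pullbackTensorIso_hom, tensorMapIso_hom]

/-- The same span on both sides (`u`, `v` endomorphisms of `X`, `Y` compatible with an endomorphism `g`
of `Z`): `g^*(E ⊠ F) ≅ (u^*E) ⊠ (v^*F)`. [cite: StacksProject, Tag 01CA (Lemma 17.16.4)] -/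
def pullbackBoxTensorIsoOfComm {g : Z ⟶ Z} {u : X ⟶ X} {v : Y ⟶ Y} (hp : g ≫ p = p ≫ u)
    (hq : g ≫ q = q ≫ v) {E : X.Modules} {F : Y.Modules} (hE : IsFiniteLocallyFree E)
    (hF : IsFiniteLocallyFree F) :
    (Scheme.Modules.pullback g).obj (boxTensor p q E F) ≅
      boxTensor p q ((Scheme.Modules.pullback u).obj E) ((Scheme.Modules.pullback v).obj F) :=
  pullbackBoxTensorIso hp hq hE hF

end Span

/-! ### §2 Translations of a product of abelian varieties: `t_{(x,y)}^*(E ⊠ F) ≅ t_x^*E ⊠ t_y^*F` -/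

section AbelianVariety

variable {K : Type u} [Field K] (A B : AbelianVariety K)

/-- On underlying schemes, `t_z ≫ p₁ = p₁ ≫ t_{p₁ z}` for the first projection of `A × B`
(`AbelianVariety.translation_comp_hom`). [cite: GortzWedhorn2023, Def./Rem. 27.1 (p. 799)] -/
theorem AbelianVariety.translation_left_comp_fst (z : (A.prod B).Points K) :
    ((A.prod B).translation z).left ≫ AbelianVariety.Hom.toSchemeHom (AbelianVariety.fst A B) =
      AbelianVariety.Hom.toSchemeHom (AbelianVariety.fst A B) ≫
        (A.translation (z ≫ (AbelianVariety.fst A B).hom.hom.hom)).left := by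
  have h := congrArg CommaMorphism.left (AbelianVariety.translation_comp_hom (AbelianVariety.fst A B) z)
  simpa only [Over.comp_left] using h

/-- On underlying schemes, `t_z ≫ p₂ = p₂ ≫ t_{p₂ z}` for the second projection of `A × B`.
[cite: GortzWedhorn2023, Def./Rem. 27.1 (p. 799)] -/
theorem AbelianVariety.translation_left_comp_snd (z : (A.prod B).Points K) :
    ((A.prod B).translation z).left ≫ AbelianVariety.Hom.toSchemeHom (AbelianVariety.snd A B) =
      AbelianVariety.Hom.toSchemeHom (AbelianVariety.snd A B) ≫
        (B.translation (z ≫ (AbelianVariety.snd A B).hom.hom.hom)).left := by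
  have h := congrArg CommaMorphism.left (AbelianVariety.translation_comp_hom (AbelianVariety.snd A B) z)
  simpa only [Over.comp_left] using h

/-- **Translation interchange for box products** (item (M3b)): for abelian varieties `A`, `B` over `K`, a
`K`-point `z` of `A × B` with components `x = p₁ z`, `y = p₂ z`, and finite locally free `E` on `A`, `F`
on `B`, **`t_z^*(E ⊠ F) ≅ (t_x^*E) ⊠ (t_y^*F)`**. [cite: StacksProject, Tag 01CA (Lemma 17.16.4)] [cite: GortzWedhorn2023, §(22.25) (p. 286) and Def./Rem. 27.1 (p. 799)] -/
def AbelianVariety.pullbackTranslationBoxTensorIso (z : (A.prod B).Points K) {E : A.X.left.Modules}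
    {F : B.X.left.Modules} (hE : IsFiniteLocallyFree E) (hF : IsFiniteLocallyFree F) :
    (Scheme.Modules.pullback ((A.prod B).translation z).left).obj (A.boxTensor B E F) ≅
      A.boxTensor B
        ((Scheme.Modules.pullback (A.translation (z ≫ (AbelianVariety.fst A B).hom.hom.hom)).left).obj E)
        ((Scheme.Modules.pullback (B.translation (z ≫ (AbelianVariety.snd A B).hom.hom.hom)).left).obj F) :=
  pullbackBoxTensorIsoOfComm (AbelianVariety.translation_left_comp_fst A B z)
    (AbelianVariety.translation_left_comp_snd A B z) hE hF

end AbelianVariety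

end Literature.AlgebraicGeometry.Modules

end
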